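import Summits.FinalStateConjecture.FinalStateConjecture.Theorems.ExactKerrEndsTameEscapeToKerrEndsChartKerrEnd
import Literature.Geometry.Lorentzian.SchwarzschildIsotropicLeaf
import HarnessLib

/-!
# Route `ExactKerrEnds`, crux `TameEscapeToKerrEnds` (stmt-FinalStateConjecture-18522), line
# `matched-kerr-solution-map`: the rest-frame Schwarzschild target of the gluing is an exact Kerr end

The unit-scale form `S1♭♭` of the line's analytic stub (session-5 analysis, the first hypothesis of
`tameEscapeToKerrEnds_of_unitKerrGluingCurve_of_pmt_of_rigidity`) asks the glued datum to be, far out,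
an EXACT spacelike Kerr leaf **and** Dafermos–Rodnianski flat on the same end chart. The Kerr–Schild
slices `Kerr.data` are exact Kerr ends but not DR-flat (`Kerr.not_isStronglyAsymptoticallyFlatDR_data`),
so every realisation of the line needs a REST-FRAME target: a Kerr leaf whose data, read in an
asymptotically Euclidean chart, have the admissible rates. For `a = 0` this is the time-symmetric
slice of Schwarzschild in isotropic coordinates, `h = (1 + M/2ρ)⁴ δ`, `k = 0`, now available in the
tree as an exact Kerr leaf (`Literature/…/SchwarzschildStaticLeaf.lean`, `…IsotropicMap.lean`,
`…IsotropicLeaf.lean`: `Schwarzschild.kerrLeaf`, `Schwarzschild.isExactKerrEndAlong_conformalData`)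
with DR rates and ADM energy `M` (`…IsotropicAsymptotics.lean`).

This file states the consequence in the form a gluing construction consumes:

* `chartSchwarzschildBeyond_isChartExactKerrBeyond` — if, beyond chart radius `ρ ≥ M/2` on an end
  `e`, the chart components of a datum `D` ARE the isotropic Schwarzschild data of mass `M ≥ 0`
  (`hCoeff e D y = (1 + M/2‖y‖)⁴ δ`, `kCoeff e D y = 0` for `ρ < ‖y‖`), then `D` is chart-exact Kerr
  beyond `ρ` (the unfolded `IsChartExactKerrBeyond e D ρ` of the line, witnesses
  `(M, 0, 2M, Schwarzschild.kerrLeaf, Schwarzschild.kerrNormal)` over `exteriorRegion ρ`);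
* `hasExactKerrEnd_of_chartSchwarzschildBeyond` — hence, on a sole end with `e.R ≤ ρ`, `D` is
  Kerr-ended (`chartKerrEnd`, S3a, landed).

So a matched gluing whose selected outer member is Schwarzschild AT REST in the end's frame
(momentum matched to `0`, which the DR class forces: `P_ADM = 0`,
`StronglyAsymptoticallyFlatADMMomentum.lean`) produces admissible-rate Kerr-ended data; the `a ≠ 0`
(Boyer–Lindquist, quasi-isotropic) analogue and the bend-to-rest leaf remain open (NOTES, Census).
-/

set_option linter.dupNamespace false

noncomputable section

namespace Summit.FinalStateConjecture.FinalStateConjecture.Theorems.ExactKerrEnds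

open scoped Manifold ContDiff InnerProductSpace
open Set Function TopologicalSpace Topology Literature.Geometry.Lorentzian

variable {X : Type} [TopologicalSpace X] [ChartedSpace E3 X] [IsManifold (𝓡 3) ∞ X]

/-- **Isotropic Schwarzschild in the chart ⇒ chart-exact Kerr beyond `ρ`.** Let `e` be an end of
`X`, `D` a datum, `0 ≤ M`, `M/2 ≤ ρ`. If for every `y` with `ρ < ‖y‖` the chart components of `D`
are `hCoeff e D y = (1 + M/2‖y‖)⁴ δ` and `kCoeff e D y = 0`, then the unfolded
`IsChartExactKerrBeyond e D ρ` of line `matched-kerr-solution-map` holds, with Kerr parameters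
`(M, a, r₀) = (M, 0, 2M)`, leaf `Schwarzschild.kerrLeaf M (exteriorRegion ρ)` (the isotropic leaf
`y ↦ (2M log(r − 2M), (1 + M/2‖y‖)² y)`, `r = ‖y‖(1 + M/2‖y‖)²`, into the ingoing Kerr–Schild
chart of Schwarzschild) and the normalised static Killing field as future unit normal.
MTW 1973, (31.22); Corvino–Schoen 2006, §1 and Thm. 4 (data identical to a Kerr slice outside a
compact set). [cite: CorvinoSchoen2006, §1 and Thm. 4] -/
theorem chartSchwarzschildBeyond_isChartExactKerrBeyond :
    ∀ {X : Type} [TopologicalSpace X] [ChartedSpace E3 X] [IsManifold (𝓡 3) ∞ X] [Kerr.Facts]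
      (e : AFEnd X) (D : InitialDataSet (𝓡 3) X) {M ρ : ℝ}, 0 ≤ M → M / 2 ≤ ρ →
      (∀ y : E3, ρ < ‖y‖ →
        AFEnd.hCoeff e D y =
          Schwarzschild.conformalFactor M y ^ 4 • (innerSL ℝ : E3 →L[ℝ] E3 →L[ℝ] ℝ)) →
      (∀ y : E3, ρ < ‖y‖ → AFEnd.kCoeff e D y = 0) →
      ∃ (M' a r₀ : ℝ) (hM' : 0 ≤ M') (ψ : exteriorRegion ρ → Kerr.region a r₀)
        (ν : NormalField 𝓘(ℝ, E4) ψ),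
        Function.Injective ψ ∧
        (Kerr.smoothMetric M' a r₀).IsSpacelikeImmersion 𝓘(ℝ, E3) ψ ∧
        (Kerr.smoothMetric M' a r₀).IsFutureUnitNormal 𝓘(ℝ, E3)
          ((Kerr.timeOrientation M' a r₀ hM').ofLE le_top) ψ ν ∧
        (∀ (y : exteriorRegion ρ) (v w : E3),
          AFEnd.hCoeff e D (y : E3) v w =
            Kerr.bilin M' a (ψ y : E4) (mfderiv 𝓘(ℝ, E3) 𝓘(ℝ, E4) ψ y v)
              (mfderiv 𝓘(ℝ, E3) 𝓘(ℝ, E4) ψ y w)) ∧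
        (∀ [(Kerr.smoothMetric M' a r₀).HasLeviCivita] (y : exteriorRegion ρ) (v w : E3),
          AFEnd.kCoeff e D (y : E3) v w =
            (Kerr.smoothMetric M' a r₀).secondFundamentalForm 𝓘(ℝ, E3) ψ ν y v w) := by
  intro X _ _ _ _ e D M ρ hM hρ hh hk
  have hU : ∀ z ∈ exteriorRegion ρ, M / 2 < ‖z‖ := fun z hz ↦ hρ.trans_lt (mem_exteriorRegion.1 hz)
  refine ⟨M, 0, 2 * M, hM, Schwarzschild.kerrLeaf M (exteriorRegion ρ) hU hM,
    Schwarzschild.kerrNormal M (exteriorRegion ρ) hU hM, Schwarzschild.kerrLeaf_injective hU hM,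
    Schwarzschild.isSpacelikeImmersion_kerrLeaf hU hM, Schwarzschild.isFutureUnitNormal_kerrNormal hU hM,
    fun y v w ↦ ?_, fun y v w ↦ ?_⟩
  · rw [hh y y.2, Schwarzschild.bilin_mfderiv_kerrLeaf hU hM y v w]
    rfl
  · rw [hk y y.2, Schwarzschild.secondFundamentalForm_kerrLeaf hU hM y v w]
    rfl

/-- **A datum which is isotropic Schwarzschild in the chart of a sole end is Kerr-ended.** On a sole
asymptotically flat end `e` of `X` with `e.R ≤ ρ`, `M/2 ≤ ρ`, `0 ≤ M`: if beyond `ρ` the chart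
components of `D` are `(1 + M/2‖y‖)⁴ δ` and `0`, then `D.HasExactKerrEnd` (via the landed stub S3a
`chartKerrEnd`). This is the rest-frame (`P_ADM = 0`, Dafermos–Rodnianski-admissible) Schwarzschild
target of an exterior gluing, as opposed to the Kerr–Schild slice target. Corvino–Schoen 2006, Thm. 4;
MTW 1973, (31.22). [cite: CorvinoSchoen2006, §1 and Thm. 4] -/
theorem hasExactKerrEnd_of_chartSchwarzschildBeyond [T2Space X] [SecondCountableTopology X]
    [ConnectedSpace X] (e : AFEnd X) (D : InitialDataSet (𝓡 3) X) {M ρ : ℝ} (hM : 0 ≤ M)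
    (hρ : M / 2 ≤ ρ) (hsole : e.IsSoleEnd) (hRρ : e.R ≤ ρ)
    (hh : ∀ y : E3, ρ < ‖y‖ →
      AFEnd.hCoeff e D y = Schwarzschild.conformalFactor M y ^ 4 • (innerSL ℝ : E3 →L[ℝ] E3 →L[ℝ] ℝ))
    (hk : ∀ y : E3, ρ < ‖y‖ → AFEnd.kCoeff e D y = 0) :
    D.HasExactKerrEnd := by
  intro hKF
  exact chartKerrEnd X e D ρ hsole hRρ
    (chartSchwarzschildBeyond_isChartExactKerrBeyond e D hM hρ hh hk)

end Summit.FinalStateConjecture.FinalStateConjecture.Theorems.ExactKerrEnds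

end
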